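import Mathlib
import Literature.NumberTheory.LFunctions.Zhang2022.Section16I3minusBounds
import Literature.NumberTheory.LFunctions.Zhang2022.Section16Step16u002
import HarnessLib

/-!
# Zhang (2022) §16 p. 89, step `Z22:§16.u004`: `I₃⁻(ψ) ≪ ε` by moving `𝔍(−α)` to `𝔍(−𝓛⁹)`, and the
# leaf `Step16_u010` ("`Φ₂ = Θ₂(β₁,𝐤₂*,𝐚₂*) + o(𝔓)`") of `theorem1_of_leaves_v19` CLOSED

Topic `Literature/NumberTheory/LFunctions/Zhang2022` (Landau–Siegel audit tree; verdict-neutral).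
Y. Zhang, *Discrete mean estimates and the Landau–Siegel zero*, arXiv:2211.02515v1 (2022)
[Zhang2022LandauSiegel] — **an unrefereed manuscript under adjudication; nothing in this file asserts or
denies its Theorems 1–2.** ZHANG-L discharge lane (WP16), node `Z22:§16.u004` (§16 p. 89, tex L4417):

> "Note that the length of the sum `B(s,ψ)N(s+β₃,ψ)` is `≤ PT⁻¹`. For `ψ ∈ Ψ₁`, moving the segment
> `𝔍(−α)` to `𝔍(−𝓛⁹)` we obtain, by simple estimation, `I₃⁻(ψ) ≪ ε`."

With the left-region size of the integrand `𝒦₂(s,ψ)ω(s)` (`Step16u010.norm_calK2_omega_le_left`,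
`Section16I3minusBounds`) the move is Cauchy's theorem on `[½−𝓛⁹, ½−α] × [2πt₀−𝓛₁, 2πt₀+𝓛₁]` (the
tree's `Section7aStatements.norm_intJ_sub_intJ_le`; holomorphy `differentiableOn_calK2_omega_left`, i.e.
Proposition 2.2 (i) reflected through the functional equation): the horizontal sides carry the Gaussian
`|ω| ≤ 6e^{−𝓛¹⁰/4}` against factors `P^{O(1)}e^{O(𝓛⁹log𝓛)}`, and on `𝔍(−𝓛⁹)` the factor
`(8/(Dt₀))^{𝓛⁹} ≤ P³e^{−𝓛¹⁰}` ("length `≤ PT⁻¹`" against the conductor) makes the integral negligible: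

* `norm_calK2_omega_le_horizontal_left`, `norm_calK2_omega_le_far_left` — the two uniform bounds;
* `step16_u004_of_prop22i : Prop22i → ∀ c′, Step16_u004 c′`, **`step16_u004_holds : ∀ c′, Step16_u004 c′`**
  (`Skeleton.prop22i_holds`) — node `Z22:§16.u004` DISCHARGED with `ε = e^{−𝓛¹⁰/16}`;
* **`Typed.Section16A.step16_u010_eventually : ∃ c₀, ∀ c′ ≥ c₀, Step16_u010 c′`** — the LEAF `h16u010`
  of `Skeleton.theorem1_of_leaves_v19` BY NAME (zl-closer-1's `Step16u010.step16_u010_of_u004_eventually`,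
  i.e. u002 `step16_u002_eventually` + this lane's `step16_u010_of`, fed with `step16_u004_holds`).

Theorems only; no definitions, no named facts; axioms standard. WHAT THIS IS NOT: (16.1) with its
`Ψ₁ → Ψ` extension, or any claim about Theorems 1–2 of the source or about Landau–Siegel zeros.

## References

* Y. Zhang, arXiv:2211.02515v1 (2022), §16 pp. 88–89 (u001–u010), §2 (2.2)–(2.15).
  [cite: Zhang2022LandauSiegel, §16 p.89 (u004), (u010)]
* H. L. Montgomery, R. C. Vaughan, *Multiplicative Number Theory I* (2007), Lemma 12.6.
  [cite: MontgomeryVaughan2007, Lemma 12.6]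
-/

noncomputable section

open Complex Real Set Metric MeasureTheory intervalIntegral
open Literature.NumberTheory.LFunctions.Zhang2022.Skeleton
open Literature.NumberTheory.LFunctions.Zhang2022.Typed.Section16A

namespace Literature.NumberTheory.LFunctions.Zhang2022.Step16u010

open Literature.NumberTheory.LFunctions.Zhang2022

/-! ## Sizes -/

section Sizes

variable {D : ℕ}

/-- The Gaussian on the horizontal sides, wide form: for `𝓛 ≥ 3` and `z² ≤ 𝓛₂²`,
`(√π/𝓛₂)·exp((z² − 𝓛₁²)/(4𝓛₂²)) ≤ 6·e^{−𝓛¹⁰/4}`. [cite: Zhang2022LandauSiegel, §2 (2.15), (7.4)] -/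
theorem omega_edge_le_wide (hℓ : 3 ≤ ell D) {z : ℝ} (hz : z ^ 2 ≤ ell2 D ^ 2) :
    Real.sqrt π / ell2 D * Real.exp ((z ^ 2 - ell1 D ^ 2) / (4 * ell2 D ^ 2)) ≤
      6 * Real.exp (-(ell D ^ 10) / 4) := by
  have hℓ1 : 1 ≤ ell D := by linarith
  have hℓ2 : 1 ≤ ell2 D := by rw [ell2]; exact one_le_pow₀ hℓ1
  have hℓ20 : 0 < ell2 D := by linarith
  have hratio : ell1 D ^ 2 / (4 * ell2 D ^ 2) = ell D ^ 10 / 4 := by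
    rw [div_eq_div_iff (by positivity) (by norm_num), ell1, ell2]; ring
  have hexp : (z ^ 2 - ell1 D ^ 2) / (4 * ell2 D ^ 2) ≤ 1 + -(ell D ^ 10) / 4 := by
    rw [sub_div, hratio]
    have : z ^ 2 / (4 * ell2 D ^ 2) ≤ 1 := by
      rw [div_le_one (by positivity)]; nlinarith
    linarith
  have hsqrt : Real.sqrt π ≤ 2 := by
    rw [Real.sqrt_le_left (by norm_num)]; linarith [Real.pi_lt_four]
  have h1 : Real.sqrt π / ell2 D ≤ 2 := (div_le_self (Real.sqrt_nonneg _) hℓ2).trans hsqrt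
  have h2 : Real.exp ((z ^ 2 - ell1 D ^ 2) / (4 * ell2 D ^ 2)) ≤
      Real.exp 1 * Real.exp (-(ell D ^ 10) / 4) := by
    rw [← Real.exp_add]; exact Real.exp_le_exp.mpr hexp
  have he : Real.exp 1 ≤ 3 := by have := Real.exp_one_lt_d9; linarith
  have h3 := Real.exp_pos (-(ell D ^ 10) / 4)
  calc Real.sqrt π / ell2 D * Real.exp ((z ^ 2 - ell1 D ^ 2) / (4 * ell2 D ^ 2))
      ≤ 2 * (Real.exp 1 * Real.exp (-(ell D ^ 10) / 4)) :=
        mul_le_mul h1 h2 (Real.exp_pos _).le (by norm_num)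
    _ ≤ 2 * (3 * Real.exp (-(ell D ^ 10) / 4)) := by gcongr
    _ = 6 * Real.exp (-(ell D ^ 10) / 4) := by ring

/-- The Gaussian near the centre of the window: for `𝓛 ≥ 3`, `z² ≤ 𝓛₂²` and any `v`,
`(√π/𝓛₂)·exp((z² − v²)/(4𝓛₂²)) ≤ 3`. [cite: Zhang2022LandauSiegel, §2 (2.15)] -/
theorem omega_le_three (hℓ : 3 ≤ ell D) {z v : ℝ} (hz : z ^ 2 ≤ ell2 D ^ 2) :
    Real.sqrt π / ell2 D * Real.exp ((z ^ 2 - v ^ 2) / (4 * ell2 D ^ 2)) ≤ 3 := by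
  have hℓ1 : 1 ≤ ell D := by linarith
  have hℓ2 : 1 ≤ ell2 D := by rw [ell2]; exact one_le_pow₀ hℓ1
  have hexp : (z ^ 2 - v ^ 2) / (4 * ell2 D ^ 2) ≤ 1 / 4 := by
    rw [div_le_iff₀ (by positivity)]; nlinarith [sq_nonneg v]
  have hsqrt : Real.sqrt π ≤ 2 := by
    rw [Real.sqrt_le_left (by norm_num)]; linarith [Real.pi_lt_four]
  have h1 : Real.sqrt π / ell2 D ≤ 2 := (div_le_self (Real.sqrt_nonneg _) hℓ2).trans hsqrt
  have h2 : Real.exp ((z ^ 2 - v ^ 2) / (4 * ell2 D ^ 2)) ≤ Real.exp (1 / 4) :=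
    Real.exp_le_exp.mpr hexp
  have he4 : Real.exp (1 / 4) ^ 4 = Real.exp 1 := by
    rw [← Real.exp_nat_mul]; norm_num
  have hq : Real.exp (1 / 4) ≤ 3 / 2 := by
    by_contra h
    push Not at h
    have h4 : (3 / 2 : ℝ) ^ 4 < Real.exp (1 / 4) ^ 4 := pow_lt_pow_left₀ h (by norm_num) (by norm_num)
    rw [he4] at h4
    have := Real.exp_one_lt_d9
    norm_num at h4
    linarith
  calc Real.sqrt π / ell2 D * Real.exp ((z ^ 2 - v ^ 2) / (4 * ell2 D ^ 2))
      ≤ 2 * (3 / 2) := mul_le_mul h1 (h2.trans hq) (Real.exp_pos _).le (by norm_num)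
    _ = 3 := by norm_num

/-- **The far-left decay**: for `D ≥ 3`, `𝓛 ≥ 3`: `(8/(Dt₀))^{𝓛⁹} ≤ P³·e^{−𝓛¹⁰}`
(`log(8/(Dt₀)) ≤ log 8 − 𝓛 ≤ 3 − 𝓛`, `P = e^{𝓛⁹}`). [cite: Zhang2022LandauSiegel, §16 p.89 (u004)] -/
theorem far_left_decay (hD : 3 ≤ D) (hℓ : 3 ≤ ell D) :
    (8 / ((D : ℝ) * t0 D)) ^ (ell D ^ 9) ≤ bigP D ^ 3 * Real.exp (-(ell D ^ 10)) := by
  have hℓ1 : 1 ≤ ell D := by linarith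
  have hD0 : (0 : ℝ) < D := by exact_mod_cast (show 0 < D by omega)
  have ht0 : 1 ≤ t0 D := by rw [t0]; exact one_le_pow₀ hℓ1
  have hbase : 0 < 8 / ((D : ℝ) * t0 D) := div_pos (by norm_num) (mul_pos hD0 (by linarith))
  have hlog8 : Real.log 8 ≤ 3 := by
    have h8 : (8 : ℝ) ≤ Real.exp 3 := by
      have h1 := Real.exp_one_gt_d9
      have h3 : Real.exp 3 = Real.exp 1 * Real.exp 1 * Real.exp 1 := by
        rw [← Real.exp_add, ← Real.exp_add]; norm_num
      rw [h3]; nlinarith [mul_pos (Real.exp_pos 1) (Real.exp_pos 1)]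
    calc Real.log 8 ≤ Real.log (Real.exp 3) := Real.log_le_log (by norm_num) h8
      _ = 3 := Real.log_exp 3
  have ht0pos : 0 < t0 D := by linarith
  have hlog : Real.log (8 / ((D : ℝ) * t0 D)) ≤ 3 - ell D := by
    rw [Real.log_div (by norm_num) (mul_pos hD0 ht0pos).ne', Real.log_mul hD0.ne' ht0pos.ne']
    have h1 : 0 ≤ Real.log (t0 D) := Real.log_nonneg ht0
    have h2 : Real.log (D : ℝ) = ell D := rfl
    linarith
  rw [Real.rpow_def_of_pos hbase]
  have hP3 : bigP D ^ 3 * Real.exp (-(ell D ^ 10)) = Real.exp (ell D ^ 9 * (3 - ell D)) := by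
    rw [bigP, ← Real.exp_nat_mul, ← Real.exp_add]; congr 1; push_cast; ring
  rw [hP3, Real.exp_le_exp]
  exact (mul_le_mul_of_nonneg_right hlog (pow_nonneg (by linarith) 9)).trans_eq (by ring)

/-- The Stirling range for `A = 𝓛⁹`: `𝓛⁹(2𝓛⁹+11) + 2(𝓛⁹+3) ≤ πt₀ − 1` for `𝓛 ≥ 10` (`t₀ = 𝓛⁵¹⁹`).
[cite: Zhang2022LandauSiegel, §2 (2.8)] -/
theorem stirling_range (hℓ : 10 ≤ ell D) :
    ell D ^ 9 * (2 * ell D ^ 9 + 11) + 2 * (ell D ^ 9 + 3) ≤ π * t0 D - 1 := by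
  have hℓ1 : 1 ≤ ell D := by linarith
  have h9 : 1 ≤ ell D ^ 9 := one_le_pow₀ hℓ1
  have h18 : ell D ^ 18 = ell D ^ 9 * ell D ^ 9 := by ring
  have h501 : 10 ≤ ell D ^ 501 := le_trans hℓ (le_self_pow₀ hℓ1 (by norm_num))
  have h519 : ell D ^ 519 = ell D ^ 18 * ell D ^ 501 := by ring
  have h18nn : 0 ≤ ell D ^ 18 := pow_nonneg (by linarith) 18
  have hbig : 10 * ell D ^ 18 ≤ ell D ^ 519 := by
    rw [h519, mul_comm]; exact mul_le_mul_of_nonneg_left h501 h18nn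
  have h1 : 3 * ell D ^ 519 ≤ π * ell D ^ 519 :=
    mul_le_mul_of_nonneg_right Real.pi_gt_three.le (pow_nonneg (by linarith) 519)
  have h2 : ell D ^ 9 ≤ ell D ^ 18 := pow_le_pow_right₀ hℓ1 (by norm_num)
  have h3 : ell D ^ 9 * (2 * ell D ^ 9 + 11) = 2 * ell D ^ 18 + 11 * ell D ^ 9 := by ring
  rw [t0, h3]
  linarith

/-- `(1/2πi)∫_{𝔍(z)}`-norm: `‖∫_{𝔍(z)} F ds‖ ≤ 2𝓛₁·M` if `|F| ≤ M` on the segment.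
[cite: Zhang2022LandauSiegel, §7 (7.4) p.34] -/
theorem norm_intJ_le_of_bound (z : ℝ) {F : ℂ → ℂ} {M : ℝ} (hℓ1 : 0 ≤ ell1 D)
    (hF : ∀ v ∈ Set.Icc (-ell1 D) (ell1 D), ‖F ((z : ℂ) + s0 D + v * I)‖ ≤ M) :
    ‖Section7aStatements.intJ D z F‖ ≤ 2 * ell1 D * M := by
  rw [Section7aStatements.intJ, Lemma81.segInt_def]
  have hnorm2 : ‖(2 : ℂ) * π * I‖ = 2 * π := by
    rw [norm_mul, norm_mul, Complex.norm_I, mul_one, Complex.norm_real, Real.norm_eq_abs,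
      abs_of_pos Real.pi_pos]
    norm_num
  have hint := intervalIntegral.norm_integral_le_of_norm_le_const (a := -ell1 D) (b := ell1 D)
    (C := M) (f := fun v : ℝ => F ((z : ℂ) + s0 D + v * I)) (fun v hv => hF v (by
      rw [Set.uIoc_of_le (by linarith)] at hv; exact ⟨hv.1.le, hv.2⟩))
  have habs : |ell1 D - -ell1 D| = 2 * ell1 D := by rw [abs_of_nonneg (by linarith)]; ring
  rw [habs] at hint
  have h1 : ‖(1 / (2 * π) : ℂ)‖ = 1 / (2 * π) := by
    rw [show (1 / (2 * π) : ℂ) = ((1 / (2 * π) : ℝ) : ℂ) by push_cast; ring, Complex.norm_real,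
      Real.norm_of_nonneg (by positivity)]
  rw [norm_mul, hnorm2, norm_mul, h1]
  have hint' : ‖∫ v in -ell1 D..ell1 D, F ((z : ℂ) + SmoothWeight.s0 (t0 D) + v * I)‖ ≤
      M * (2 * ell1 D) := hint
  calc 2 * π * (1 / (2 * π) * ‖∫ v in -ell1 D..ell1 D, F ((z : ℂ) + SmoothWeight.s0 (t0 D) + v * I)‖)
      = ‖∫ v in -ell1 D..ell1 D, F ((z : ℂ) + SmoothWeight.s0 (t0 D) + v * I)‖ := by
        rw [← mul_assoc, show (2 * π) * (1 / (2 * π)) = 1 by field_simp, one_mul]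
    _ ≤ M * (2 * ell1 D) := hint'
    _ = 2 * ell1 D * M := by ring

end Sizes

/-! ## The two uniform bounds for `𝒦₂ω` left of the line -/

section Uniform

variable (c' : ℝ) {D : ℕ} [NeZero D] {χ : DirichletCharacter ℂ D} (x : Chr D)

/-- **Horizontal sides of the left rectangle**: for `ψ ∈ Ψ₁` (zeros on the line), `D ≥ 3`, `χ`
primitive, `𝓛 ≥ 10`, `π|c′| ≤ 𝓛⁸`, on `s = u + i(2πt₀ ± 𝓛₁)`, `½ − 𝓛⁹ ≤ u ≤ ½ − α`:
`|𝒦₂(s)ω(s)| ≤ K₁·P¹⁰·exp(3C𝓛⁹(1+9log𝓛))·e^{−𝓛¹⁰/4}`, `K₁ = e³·72576·K_B·Z`.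
[cite: Zhang2022LandauSiegel, §16 p.89 (u004)] -/
theorem norm_calK2_omega_le_horizontal_left {C : ℝ} (hC0 : 0 < C)
    (hC : ∀ (q : ℕ) [NeZero q] (θ : DirichletCharacter ℂ q), θ ≠ 1 → ∀ t σ d : ℝ,
      1 / 2 ≤ σ → σ ≤ 2 → 0 < d → d ≤ 1 →
        (∀ ρ ∈ DirichletDisc.discZeros θ t, ∀ y ∈ Icc σ 2, d ≤ ‖(y : ℂ) + t * I - ρ‖) →
          Real.exp (-(C * (1 + Real.log (1 / d)) * (Real.log q + Real.log (|t| + 4)))) ≤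
            ‖θ.LFunction ((σ : ℂ) + t * I)‖)
    (h22 : ∀ s ∈ prodZeroSetOmega χ x, s.re = 1 / 2) (hD : 3 ≤ D) (hp : χ.IsPrimitive)
    (hℓ : 10 ≤ ell D) (hc : π * |c'| ≤ ell D ^ 8)
    {u : ℝ} (hu1 : 1 / 2 + -(ell D ^ 9) ≤ u) (hu2 : u ≤ 1 / 2 + -alpha D) {t : ℝ}
    (ht : t = 2 * π * t0 D + ell1 D ∨ t = 2 * π * t0 D - ell1 D) :
    ‖calK2 c' χ x ((u : ℂ) + t * I) * omegaW D ((u : ℂ) + t * I)‖ ≤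
      (Real.exp 3 * 72576 * ((1 + ‖iota2‖) * (‖iota3‖ + ‖iota4‖)) * DirichletDisc.Zc) * bigP D ^ 10 *
        Real.exp (3 * C * ell D ^ 9 * (1 + 9 * Real.log (ell D))) *
        Real.exp (-(ell D ^ 10) / 4) := by
  have hℓ3 : 3 ≤ ell D := by linarith
  have hℓ1 : 1 ≤ ell D := by linarith
  have hℓ2 : 2 ≤ ell D := by linarith
  obtain ⟨hα0, hα6, hα1⟩ := Step8u016.alpha_small hℓ3
  obtain ⟨hwin, hℓ1t0, ht01, hℓ21, hℓ10⟩ := Step8u016.window_sizes hℓ3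
  have hcα := Step8u016.abs_c_mul_alpha_ell_le_one (c' := c') hℓ3 hc
  obtain ⟨hb1, -, -⟩ := Step8u016.abs_b_le_one c' hα0.le hα6 hcα
  have hπ3 := Real.pi_gt_three
  have ht00 : 0 < t0 D := by linarith
  set A : ℝ := ell D ^ 9 with hA
  have hA1 : 1 ≤ A := one_le_pow₀ hℓ1
  have hStir := stirling_range hℓ
  have hℓ1π : ell1 D ≤ π * t0 D :=
    hℓ1t0.trans (le_mul_of_one_le_left ht00.le (by linarith))
  set s : ℂ := (u : ℂ) + t * I with hs
  have hsre : s.re = u := by simp [hs]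
  have hsim : s.im = t := by simp [hs]
  have hw0 : 0 ≤ 1 / 2 - s.re := by rw [hsre]; linarith
  have hwα : alpha D ≤ 1 / 2 - s.re := by rw [hsre]; linarith
  have hwA : 1 / 2 - s.re ≤ A := by rw [hsre]; linarith
  have htabs : |s.im - 2 * π * t0 D| ≤ ell1 D := by
    rw [hsim]
    rcases ht with ht' | ht'
    · rw [ht', show 2 * π * t0 D + ell1 D - 2 * π * t0 D = ell1 D by ring, abs_of_nonneg hℓ10]
    · rw [ht', show 2 * π * t0 D - ell1 D - 2 * π * t0 D = -ell1 D by ring, abs_neg,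
        abs_of_nonneg hℓ10]
  -- the reflected lower bound `Λ = 2E`
  set E : ℝ := Real.exp (C * (1 + Real.log (1 / alpha D)) * (Real.log x.p + Real.log (|s.im| + 4)))
    with hE
  have hΛ := norm_inv_LFunction_reflect_le x hC0 hC h22 hα0 hα1 (s := s) hwα htabs
  have hmaster := norm_calK2_omega_le_left c' x hD hp hℓ hb1 hA1 hStir hℓ1π hw0 hwA htabs hΛ
  refine hmaster.trans ?_
  -- sizes
  have hP0 : 0 < bigP D := Real.exp_pos _
  have hP1 : 1 ≤ bigP D := Real.one_le_exp (pow_nonneg (Real.log_natCast_nonneg D) 9)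
  have hp3 := Step8u016.chr_p_le_three_bigP hℓ3 x
  have hp1 : (1 : ℝ) ≤ x.p := by exact_mod_cast x.prime.one_lt.le
  have ht0P := Step8u016.t0_le_bigP hℓ3
  have hD0 : (0 : ℝ) < D := by exact_mod_cast (show 0 < D by omega)
  have hD3 : (3 : ℝ) ≤ D := by exact_mod_cast hD
  have hP4 := P4_le_bigP_sq hℓ3
  have hP40 : 0 ≤ P4 D := Typed.Section16ALeaves.P4_nonneg D
  have hZ1 : 1 ≤ DirichletDisc.Zc := DirichletDisc.one_le_Zc
  set KB : ℝ := (1 + ‖iota2‖) * (‖iota3‖ + ‖iota4‖) with hKB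
  have hKB0 : 0 ≤ KB := by rw [hKB]; positivity
  have hAP : A ≤ bigP D := by
    rw [hA, bigP]; linarith [Real.add_one_le_exp (ell D ^ 9)]
  have hT8 : 2 * π * t0 D ≤ 7 * t0 D :=
    mul_le_mul_of_nonneg_right (by linarith [Real.pi_lt_d2]) ht00.le
  have httri : |s.im| + 4 ≤ 12 * bigP D := by
    have h := abs_le.mp htabs
    have hpos : 0 < s.im := by linarith
    rw [abs_of_pos hpos]
    linarith
  -- factor 1: `(8/(Dt₀))^w ≤ 1`
  have hDt : 0 < (D : ℝ) * t0 D := mul_pos hD0 ht00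
  have f1 : Real.exp 3 * (8 / ((D : ℝ) * t0 D)) ^ (1 / 2 - s.re) ≤ Real.exp 3 * 1 := by
    refine mul_le_mul_of_nonneg_left ?_ (Real.exp_pos 3).le
    refine Real.rpow_le_one (div_pos (by norm_num) hDt).le ?_ hw0
    rw [div_le_one hDt]
    have ht10 : 10 ≤ t0 D := le_trans hℓ (by rw [t0]; exact le_self_pow₀ hℓ1 (by norm_num))
    have : (3 : ℝ) * 10 ≤ (D : ℝ) * t0 D := mul_le_mul hD3 ht10 (by norm_num) hD0.le
    linarith
  -- factor 2: `S_B ≤ 16 K_B P⁴`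
  have f2 := sum_norm_b1coef_le c' (χ := χ) hℓ2
  -- factor 3: `(2P₄+1)² ≤ 9P⁴`
  have f3 : (2 * P4 D + 1) ^ 2 ≤ (3 * bigP D ^ 2) ^ 2 := by
    apply pow_le_pow_left₀ (by positivity)
    have := one_le_pow₀ (M₀ := ℝ) hP1 (n := 2)
    linarith
  -- factor 4: `p(A+3+10t₀)Z ≤ 3P·14P·Z`
  have f4 : (x.p : ℝ) * (A + 3 + 10 * t0 D) * DirichletDisc.Zc ≤
      3 * bigP D * (14 * bigP D) * DirichletDisc.Zc := by
    apply mul_le_mul_of_nonneg_right _ (by linarith)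
    exact mul_le_mul hp3 (by linarith) (by positivity) (by positivity)
  -- factor 5: `Λ = 2E ≤ 2·exp(3C𝓛⁹(1+9log𝓛))`
  have f5 : 2 * E ≤ 2 * Real.exp (3 * C * ell D ^ 9 * (1 + 9 * Real.log (ell D))) := by
    refine mul_le_mul_of_nonneg_left ?_ (by norm_num)
    rw [hE, Real.exp_le_exp, mul_assoc]
    have h := Step8u016.log_factor_le hℓ3 hp1 hp3 httri
    calc C * ((1 + Real.log (1 / alpha D)) * (Real.log x.p + Real.log (|s.im| + 4)))
        ≤ C * ((1 + 9 * Real.log (ell D)) * (3 * ell D ^ 9)) := mul_le_mul_of_nonneg_left h hC0.le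
      _ = 3 * C * ell D ^ 9 * (1 + 9 * Real.log (ell D)) := by ring
  -- factor 6: the Gaussian
  have f6 : Real.sqrt π / ell2 D * Real.exp (((1 / 2 - s.re) ^ 2 - (s.im - 2 * π * t0 D) ^ 2) /
      (4 * ell2 D ^ 2)) ≤ 6 * Real.exp (-(ell D ^ 10) / 4) := by
    have hsq : (s.im - 2 * π * t0 D) ^ 2 = ell1 D ^ 2 := by
      rw [hsim]; rcases ht with ht' | ht' <;> rw [ht'] <;> ring
    rw [hsq]
    refine omega_edge_le_wide hℓ3 ?_
    have hwA' : 1 / 2 - s.re ≤ ell2 D := by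
      refine hwA.trans ?_
      rw [hA, ell2]; exact pow_le_pow_right₀ hℓ1 (by norm_num)
    exact pow_le_pow_left₀ hw0 hwA' 2
  -- combine
  have h0E : 0 ≤ 2 * E := by positivity
  have h0f4 : 0 ≤ (x.p : ℝ) * (A + 3 + 10 * t0 D) * DirichletDisc.Zc := by positivity
  have h0f2 : 0 ≤ ∑ n ∈ Finset.Ico 1 ⌈bigP D⌉₊, ‖b1coef c' χ n‖ :=
    Finset.sum_nonneg fun n _ => norm_nonneg _
  have h0f3 : 0 ≤ (2 * P4 D + 1) ^ 2 := sq_nonneg _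
  have h0ω : 0 ≤ Real.sqrt π / ell2 D * Real.exp (((1 / 2 - s.re) ^ 2 -
      (s.im - 2 * π * t0 D) ^ 2) / (4 * ell2 D ^ 2)) :=
    mul_nonneg (div_nonneg (Real.sqrt_nonneg _) (by linarith)) (Real.exp_pos _).le
  calc Real.exp 3 * (8 / ((D : ℝ) * t0 D)) ^ (1 / 2 - s.re) *
        (∑ n ∈ Finset.Ico 1 ⌈bigP D⌉₊, ‖b1coef c' χ n‖) * (2 * P4 D + 1) ^ 2 *
        ((x.p : ℝ) * (A + 3 + 10 * t0 D) * DirichletDisc.Zc) * (2 * E) *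
        (Real.sqrt π / ell2 D * Real.exp (((1 / 2 - s.re) ^ 2 - (s.im - 2 * π * t0 D) ^ 2) /
          (4 * ell2 D ^ 2)))
      ≤ Real.exp 3 * 1 * (16 * KB * bigP D ^ 4) * (3 * bigP D ^ 2) ^ 2 *
        (3 * bigP D * (14 * bigP D) * DirichletDisc.Zc) *
        (2 * Real.exp (3 * C * ell D ^ 9 * (1 + 9 * Real.log (ell D)))) *
        (6 * Real.exp (-(ell D ^ 10) / 4)) := by
        have g1 := mul_le_mul f1 f2 h0f2 (by positivity)
        have g2 := mul_le_mul g1 f3 h0f3 (by positivity)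
        have g3 := mul_le_mul g2 f4 h0f4 (by positivity)
        have g4 := mul_le_mul g3 f5 h0E (by positivity)
        exact mul_le_mul g4 f6 h0ω (by positivity)
    _ = (Real.exp 3 * 72576 * KB * DirichletDisc.Zc) * bigP D ^ 10 *
        Real.exp (3 * C * ell D ^ 9 * (1 + 9 * Real.log (ell D))) *
        Real.exp (-(ell D ^ 10) / 4) := by ring

/-- **The far-left side `𝔍(−𝓛⁹)`**: for `ψ ∈ Ψ₁`, `D ≥ 3`, `χ` primitive, `𝓛 ≥ 10`, `π|c′| ≤ 𝓛⁸`, on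
`s = −𝓛⁹ + s₀ + iv`, `|v| ≤ 𝓛₁`: `|𝒦₂(s)ω(s)| ≤ K₂·P¹³·e^{−𝓛¹⁰}`, `K₂ = e³·36288·K_B·Z`
(the decay `(8/(Dt₀))^{𝓛⁹} ≤ P³e^{−𝓛¹⁰}`; `|L(1−s,ψ̄)|⁻¹ ≤ 2` as `Re(1−s̄) = ½ + 𝓛⁹ ≥ 2`).
[cite: Zhang2022LandauSiegel, §16 p.89 (u004)] -/
theorem norm_calK2_omega_le_far_left (hD : 3 ≤ D) (hp : χ.IsPrimitive)
    (hℓ : 10 ≤ ell D) (hc : π * |c'| ≤ ell D ^ 8) {v : ℝ} (hv : v ∈ Set.Icc (-ell1 D) (ell1 D)) :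
    ‖calK2 c' χ x (((-(ell D ^ 9) : ℝ) : ℂ) + s0 D + v * I) *
        omegaW D (((-(ell D ^ 9) : ℝ) : ℂ) + s0 D + v * I)‖ ≤
      (Real.exp 3 * 36288 * ((1 + ‖iota2‖) * (‖iota3‖ + ‖iota4‖)) * DirichletDisc.Zc) *
        bigP D ^ 13 * Real.exp (-(ell D ^ 10)) := by
  have hℓ3 : 3 ≤ ell D := by linarith
  have hℓ1 : 1 ≤ ell D := by linarith
  have hℓ2 : 2 ≤ ell D := by linarith
  obtain ⟨hα0, hα6, hα1⟩ := Step8u016.alpha_small hℓ3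
  obtain ⟨hwin, hℓ1t0, ht01, hℓ21, hℓ10⟩ := Step8u016.window_sizes hℓ3
  have hcα := Step8u016.abs_c_mul_alpha_ell_le_one (c' := c') hℓ3 hc
  obtain ⟨hb1, -, -⟩ := Step8u016.abs_b_le_one c' hα0.le hα6 hcα
  have hπ3 := Real.pi_gt_three
  have ht00 : 0 < t0 D := by linarith
  set A : ℝ := ell D ^ 9 with hA
  have hA1 : 1 ≤ A := one_le_pow₀ hℓ1
  have hA10 : 10 ≤ A := le_trans hℓ (by rw [hA]; exact le_self_pow₀ hℓ1 (by norm_num))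
  have hStir := stirling_range hℓ
  have hℓ1π : ell1 D ≤ π * t0 D :=
    hℓ1t0.trans (le_mul_of_one_le_left ht00.le (by linarith))
  set s : ℂ := ((-A : ℝ) : ℂ) + s0 D + v * I with hs
  have hsre : s.re = 1 / 2 - A := by
    rw [hs, show s0 D = SmoothWeight.s0 (t0 D) from rfl, SmoothWeight.s0_def]; simp; ring
  have hsim : s.im = 2 * π * t0 D + v := by
    rw [hs, show s0 D = SmoothWeight.s0 (t0 D) from rfl, SmoothWeight.s0_def]; simp
  have hw0 : 0 ≤ 1 / 2 - s.re := by rw [hsre]; linarith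
  have hwA : 1 / 2 - s.re ≤ A := by rw [hsre]; linarith
  have htabs : |s.im - 2 * π * t0 D| ≤ ell1 D := by
    rw [hsim, show 2 * π * t0 D + v - 2 * π * t0 D = v by ring]; exact abs_le.mpr hv
  have hΛ := norm_inv_LFunction_reflect_le_two x (s := s) (by rw [hsre]; linarith)
  have hmaster := norm_calK2_omega_le_left c' x hD hp hℓ hb1 hA1 hStir hℓ1π hw0 hwA htabs hΛ
  refine hmaster.trans ?_
  -- sizes
  have hP0 : 0 < bigP D := Real.exp_pos _
  have hP1 : 1 ≤ bigP D := Real.one_le_exp (pow_nonneg (Real.log_natCast_nonneg D) 9)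
  have hp3 := Step8u016.chr_p_le_three_bigP hℓ3 x
  have ht0P := Step8u016.t0_le_bigP hℓ3
  have hP4 := P4_le_bigP_sq hℓ3
  have hP40 : 0 ≤ P4 D := Typed.Section16ALeaves.P4_nonneg D
  have hZ1 : 1 ≤ DirichletDisc.Zc := DirichletDisc.one_le_Zc
  set KB : ℝ := (1 + ‖iota2‖) * (‖iota3‖ + ‖iota4‖) with hKB
  have hKB0 : 0 ≤ KB := by rw [hKB]; positivity
  have hAP : A ≤ bigP D := by
    rw [hA, bigP]; linarith [Real.add_one_le_exp (ell D ^ 9)]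
  -- factor 1: the decay
  have f1 : Real.exp 3 * (8 / ((D : ℝ) * t0 D)) ^ (1 / 2 - s.re) ≤
      Real.exp 3 * (bigP D ^ 3 * Real.exp (-(ell D ^ 10))) := by
    refine mul_le_mul_of_nonneg_left ?_ (Real.exp_pos 3).le
    rw [hsre, show 1 / 2 - (1 / 2 - A) = A by ring, hA]
    exact far_left_decay hD hℓ3
  have f2 := sum_norm_b1coef_le c' (χ := χ) hℓ2
  have f3 : (2 * P4 D + 1) ^ 2 ≤ (3 * bigP D ^ 2) ^ 2 := by
    apply pow_le_pow_left₀ (by positivity)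
    have := one_le_pow₀ (M₀ := ℝ) hP1 (n := 2)
    linarith
  have f4 : (x.p : ℝ) * (A + 3 + 10 * t0 D) * DirichletDisc.Zc ≤
      3 * bigP D * (14 * bigP D) * DirichletDisc.Zc := by
    apply mul_le_mul_of_nonneg_right _ (by linarith)
    exact mul_le_mul hp3 (by linarith) (by positivity) (by positivity)
  have f6 : Real.sqrt π / ell2 D * Real.exp (((1 / 2 - s.re) ^ 2 - (s.im - 2 * π * t0 D) ^ 2) /
      (4 * ell2 D ^ 2)) ≤ 3 := by
    refine omega_le_three hℓ3 ?_
    have hwA' : 1 / 2 - s.re ≤ ell2 D := by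
      refine hwA.trans ?_
      rw [hA, ell2]; exact pow_le_pow_right₀ hℓ1 (by norm_num)
    exact pow_le_pow_left₀ hw0 hwA' 2
  have h0f4 : 0 ≤ (x.p : ℝ) * (A + 3 + 10 * t0 D) * DirichletDisc.Zc := by positivity
  have h0f2 : 0 ≤ ∑ n ∈ Finset.Ico 1 ⌈bigP D⌉₊, ‖b1coef c' χ n‖ :=
    Finset.sum_nonneg fun n _ => norm_nonneg _
  have h0f3 : 0 ≤ (2 * P4 D + 1) ^ 2 := sq_nonneg _
  have h0ω : 0 ≤ Real.sqrt π / ell2 D * Real.exp (((1 / 2 - s.re) ^ 2 -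
      (s.im - 2 * π * t0 D) ^ 2) / (4 * ell2 D ^ 2)) :=
    mul_nonneg (div_nonneg (Real.sqrt_nonneg _) (by linarith)) (Real.exp_pos _).le
  calc Real.exp 3 * (8 / ((D : ℝ) * t0 D)) ^ (1 / 2 - s.re) *
        (∑ n ∈ Finset.Ico 1 ⌈bigP D⌉₊, ‖b1coef c' χ n‖) * (2 * P4 D + 1) ^ 2 *
        ((x.p : ℝ) * (A + 3 + 10 * t0 D) * DirichletDisc.Zc) * 2 *
        (Real.sqrt π / ell2 D * Real.exp (((1 / 2 - s.re) ^ 2 - (s.im - 2 * π * t0 D) ^ 2) /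
          (4 * ell2 D ^ 2)))
      ≤ Real.exp 3 * (bigP D ^ 3 * Real.exp (-(ell D ^ 10))) * (16 * KB * bigP D ^ 4) *
        (3 * bigP D ^ 2) ^ 2 * (3 * bigP D * (14 * bigP D) * DirichletDisc.Zc) * 2 * 3 := by
        have g1 := mul_le_mul f1 f2 h0f2 (by positivity)
        have g2 := mul_le_mul g1 f3 h0f3 (by positivity)
        have g3 := mul_le_mul g2 f4 h0f4 (by positivity)
        have g4 : _ * (2 : ℝ) ≤ _ * 2 := mul_le_mul_of_nonneg_right g3 (by norm_num)
        exact mul_le_mul g4 f6 h0ω (by positivity)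
    _ = (Real.exp 3 * 36288 * KB * DirichletDisc.Zc) * bigP D ^ 13 * Real.exp (-(ell D ^ 10)) := by
        ring

end Uniform

/-! ## `Z22:§16.u004`: `I₃⁻(ψ) ≪ ε` -/

section Assembly

variable (c' : ℝ) {D : ℕ} [NeZero D] {χ : DirichletCharacter ℂ D} (x : Chr D)

/-- **The contour move** (core of `Z22:§16.u004`): for `ψ ∈ Ψ₁` (zeros on the line), `D ≥ 3`, `χ`
primitive, `𝓛 ≥ 10`, `π|c′| ≤ 𝓛⁸`:
`2π·‖I₃⁻(ψ)‖ ≤ (𝓛⁹ − α)·2M_H + 2𝓛₁·M_V`, with the horizontal bound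
`M_H = K₁P¹⁰e^{3C𝓛⁹(1+9log𝓛)}e^{−𝓛¹⁰/4}` and the far-side bound `M_V = K₂P¹³e^{−𝓛¹⁰}` (Cauchy's theorem
on `[½−𝓛⁹, ½−α] × [2πt₀−𝓛₁, 2πt₀+𝓛₁]`, tree `Section7aStatements.norm_intJ_sub_intJ_le`).
[cite: Zhang2022LandauSiegel, §16 p.89 (u004)] -/
theorem norm_I3pm_neg_mul_le {C : ℝ} (hC0 : 0 < C)
    (hC : ∀ (q : ℕ) [NeZero q] (θ : DirichletCharacter ℂ q), θ ≠ 1 → ∀ t σ d : ℝ,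
      1 / 2 ≤ σ → σ ≤ 2 → 0 < d → d ≤ 1 →
        (∀ ρ ∈ DirichletDisc.discZeros θ t, ∀ y ∈ Icc σ 2, d ≤ ‖(y : ℂ) + t * I - ρ‖) →
          Real.exp (-(C * (1 + Real.log (1 / d)) * (Real.log q + Real.log (|t| + 4)))) ≤
            ‖θ.LFunction ((σ : ℂ) + t * I)‖)
    (h22 : ∀ s ∈ prodZeroSetOmega χ x, s.re = 1 / 2) (hD : 3 ≤ D) (hp : χ.IsPrimitive)
    (hℓ : 10 ≤ ell D) (hc : π * |c'| ≤ ell D ^ 8) :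
    ‖I3pm c' χ x (-alpha D)‖ * (2 * π) ≤
      (ell D ^ 9 - alpha D) * (2 * ((Real.exp 3 * 72576 * ((1 + ‖iota2‖) * (‖iota3‖ + ‖iota4‖)) *
          DirichletDisc.Zc) * bigP D ^ 10 * Real.exp (3 * C * ell D ^ 9 * (1 + 9 * Real.log (ell D))) *
          Real.exp (-(ell D ^ 10) / 4))) +
        2 * ell1 D * ((Real.exp 3 * 36288 * ((1 + ‖iota2‖) * (‖iota3‖ + ‖iota4‖)) *
          DirichletDisc.Zc) * bigP D ^ 13 * Real.exp (-(ell D ^ 10))) := by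
  have hℓ3 : 3 ≤ ell D := by linarith
  have hℓ1 : 1 ≤ ell D := by linarith
  obtain ⟨hα0, -, hα1⟩ := Step8u016.alpha_small hℓ3
  obtain ⟨hwin, -, -, -, hℓ1nn⟩ := Step8u016.window_sizes hℓ3
  set A : ℝ := ell D ^ 9 with hA
  have hαA : alpha D ≤ A := hα1.trans (one_le_pow₀ hℓ1)
  set F : ℂ → ℂ := fun s => calK2 c' χ x s * omegaW D s with hF
  set MH : ℝ := (Real.exp 3 * 72576 * ((1 + ‖iota2‖) * (‖iota3‖ + ‖iota4‖)) * DirichletDisc.Zc) *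
    bigP D ^ 10 * Real.exp (3 * C * ell D ^ 9 * (1 + 9 * Real.log (ell D))) *
    Real.exp (-(ell D ^ 10) / 4) with hMH
  set MV : ℝ := (Real.exp 3 * 36288 * ((1 + ‖iota2‖) * (‖iota3‖ + ‖iota4‖)) * DirichletDisc.Zc) *
    bigP D ^ 13 * Real.exp (-(ell D ^ 10)) with hMV
  -- the horizontal sides
  have hside : ∀ t : ℝ, (t = 2 * π * t0 D + ell1 D ∨ t = 2 * π * t0 D - ell1 D) →
      ∀ u ∈ Set.Icc (1 / 2 + -A) (1 / 2 + -alpha D), ‖F ((u : ℂ) + ((t : ℝ) : ℂ) * I)‖ ≤ MH :=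
    fun t ht u hu => norm_calK2_omega_le_horizontal_left c' x hC0 hC h22 hD hp hℓ hc hu.1 hu.2 ht
  have hdiff := differentiableOn_calK2_omega_left c' x hD hp h22 hα0 hαA hwin
  have hmove := Section7aStatements.norm_intJ_sub_intJ_le D (z₁ := -A) (z₂ := -alpha D)
    (M₁ := MH) (M₂ := MH) (by linarith) hdiff (hside _ (Or.inl rfl)) (hside _ (Or.inr rfl))
  -- the far side
  have hfar : ‖Section7aStatements.intJ D (-A) F‖ ≤ 2 * ell1 D * MV :=
    norm_intJ_le_of_bound (-A) hℓ1nn fun v hv => norm_calK2_omega_le_far_left c' x hD hp hℓ hc hv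
  -- `I₃⁻ = intJ(−α)/(2πi)`, `intJ(−α) = (intJ(−α) − intJ(−A)) + intJ(−A)`
  have hI : I3pm c' χ x (-alpha D) = Section7aStatements.intJ D (-alpha D) F / (2 * π * I) := by
    rw [I3pm, Step8u016.segInt_eq_intJ_div]
  have hnorm2 : ‖(2 : ℂ) * π * I‖ = 2 * π := by
    rw [norm_mul, norm_mul, Complex.norm_I, mul_one, Complex.norm_real, Real.norm_eq_abs,
      abs_of_pos Real.pi_pos]
    norm_num
  rw [hI, norm_div, hnorm2, div_mul_cancel₀ _ (by positivity)]
  calc ‖Section7aStatements.intJ D (-alpha D) F‖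
      = ‖(Section7aStatements.intJ D (-alpha D) F - Section7aStatements.intJ D (-A) F) +
          Section7aStatements.intJ D (-A) F‖ := by rw [sub_add_cancel]
    _ ≤ ‖Section7aStatements.intJ D (-alpha D) F - Section7aStatements.intJ D (-A) F‖ +
          ‖Section7aStatements.intJ D (-A) F‖ := norm_add_le _ _
    _ ≤ (-alpha D - -A) * (MH + MH) + 2 * ell1 D * MV := add_le_add hmove hfar
    _ = (A - alpha D) * (2 * MH) + 2 * ell1 D * MV := by ring

/-- **The numerical tail of `Z22:§16.u004`**: for `𝓛 ≥ 10` with `64·4(K₁+K₂) + 1 ≤ 𝓛` and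
`(8(14+57C))² ≤ 𝓛`: `(𝓛⁹ − α)·2M_H + 2𝓛₁·M_V ≤ e^{−𝓛¹⁰/16}·(2π)` (`P¹⁴e^{3C𝓛⁹(1+9log𝓛)} ≤ e^{𝓛¹⁰/8}` by
`Step8u016.growth_le`, `4(K₁+K₂) ≤ e^{𝓛¹⁰/16}`). [cite: Zhang2022LandauSiegel, §16 p.89 (u004)] -/
theorem tail_u004_le {C K₁ K₂ : ℝ} (hC0 : 0 < C) (hK₁ : 0 ≤ K₁) (hK₂ : 0 ≤ K₂) {D : ℕ}
    (hℓ : 10 ≤ ell D) (hℓK : 64 * (4 * (K₁ + K₂)) + 1 ≤ ell D) (hℓA : (8 * (14 + 57 * C)) ^ 2 ≤ ell D) :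
    (ell D ^ 9 - alpha D) * (2 * (K₁ * bigP D ^ 10 *
        Real.exp (3 * C * ell D ^ 9 * (1 + 9 * Real.log (ell D))) * Real.exp (-(ell D ^ 10) / 4))) +
      2 * ell1 D * (K₂ * bigP D ^ 13 * Real.exp (-(ell D ^ 10))) ≤
      1 * Real.exp (-(1 / 16) * ell D ^ 10) * (2 * π) := by
  have hℓ3 : 3 ≤ ell D := by linarith
  have hℓ1 : 1 ≤ ell D := by linarith
  have hℓ0 : 0 < ell D := by linarith
  obtain ⟨hα0, -, -⟩ := Step8u016.alpha_small hℓ3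
  have hP0 : 0 < bigP D := Real.exp_pos _
  have hP1 : 1 ≤ bigP D := Real.one_le_exp (pow_nonneg (Real.log_natCast_nonneg D) 9)
  have hAP : ell D ^ 9 ≤ bigP D := by rw [bigP]; linarith [Real.add_one_le_exp (ell D ^ 9)]
  have hℓ1P : ell1 D ≤ bigP D := by
    have : ell1 D ≤ ell D ^ 519 := by rw [ell1]; exact pow_le_pow_right₀ hℓ1 (by norm_num)
    exact this.trans (Step8u016.t0_le_bigP hℓ3)
  set E' : ℝ := Real.exp (3 * C * ell D ^ 9 * (1 + 9 * Real.log (ell D))) with hE'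
  have hE'1 : 1 ≤ E' := by
    rw [hE']; apply Real.one_le_exp
    have : 0 ≤ Real.log (ell D) := Real.log_nonneg hℓ1
    positivity
  set X : ℝ := bigP D ^ 14 * E' * Real.exp (-(ell D ^ 10) / 4) with hX
  have hX0 : 0 ≤ X := by positivity
  have hexp4 : Real.exp (-(ell D ^ 10)) ≤ Real.exp (-(ell D ^ 10) / 4) :=
    Real.exp_le_exp.mpr (by have := pow_nonneg hℓ0.le 10; linarith)
  -- the horizontal piece `≤ 2K₁X`
  have hH : (ell D ^ 9 - alpha D) * (2 * (K₁ * bigP D ^ 10 * E' * Real.exp (-(ell D ^ 10) / 4))) ≤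
      2 * (K₁ * X) := by
    have h1 : ell D ^ 9 - alpha D ≤ bigP D := by linarith
    have hY0 : 0 ≤ 2 * (K₁ * bigP D ^ 10 * E' * Real.exp (-(ell D ^ 10) / 4)) := by positivity
    have hp11 : bigP D ^ 11 ≤ bigP D ^ 14 := pow_le_pow_right₀ hP1 (by norm_num)
    have hE0 : 0 ≤ E' := by linarith
    calc (ell D ^ 9 - alpha D) * (2 * (K₁ * bigP D ^ 10 * E' * Real.exp (-(ell D ^ 10) / 4)))
        ≤ bigP D * (2 * (K₁ * bigP D ^ 10 * E' * Real.exp (-(ell D ^ 10) / 4))) :=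
          mul_le_mul_of_nonneg_right h1 hY0
      _ = 2 * (K₁ * (bigP D ^ 11 * (E' * Real.exp (-(ell D ^ 10) / 4)))) := by ring
      _ ≤ 2 * (K₁ * (bigP D ^ 14 * (E' * Real.exp (-(ell D ^ 10) / 4)))) := by
          have h3 : bigP D ^ 11 * (E' * Real.exp (-(ell D ^ 10) / 4)) ≤
              bigP D ^ 14 * (E' * Real.exp (-(ell D ^ 10) / 4)) :=
            mul_le_mul_of_nonneg_right hp11 (mul_nonneg hE0 (Real.exp_pos (-(ell D ^ 10) / 4)).le)
          have h4 := mul_le_mul_of_nonneg_left h3 hK₁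
          linarith
      _ = 2 * (K₁ * X) := by rw [hX]; ring
  -- the far piece `≤ 2K₂X`
  have hV : 2 * ell1 D * (K₂ * bigP D ^ 13 * Real.exp (-(ell D ^ 10))) ≤ 2 * (K₂ * X) := by
    have hY0 : 0 ≤ K₂ * bigP D ^ 13 * Real.exp (-(ell D ^ 10)) := by positivity
    have hP13 : 0 ≤ bigP D ^ 13 := by positivity
    calc 2 * ell1 D * (K₂ * bigP D ^ 13 * Real.exp (-(ell D ^ 10)))
        ≤ 2 * bigP D * (K₂ * bigP D ^ 13 * Real.exp (-(ell D ^ 10))) := by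
          refine mul_le_mul_of_nonneg_right ?_ hY0; linarith
      _ = 2 * (K₂ * (bigP D ^ 14 * (1 * Real.exp (-(ell D ^ 10))))) := by ring
      _ ≤ 2 * (K₂ * (bigP D ^ 14 * (E' * Real.exp (-(ell D ^ 10) / 4)))) := by
          have h1 : 1 * Real.exp (-(ell D ^ 10)) ≤ E' * Real.exp (-(ell D ^ 10) / 4) :=
            mul_le_mul hE'1 hexp4 (Real.exp_pos _).le (by linarith)
          have h2 := mul_le_mul_of_nonneg_left h1 (pow_nonneg hP0.le 14)
          have h3 := mul_le_mul_of_nonneg_left h2 hK₂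
          linarith
      _ = 2 * (K₂ * X) := by rw [hX]; ring
  -- `4(K₁+K₂)·X ≤ e^{−𝓛¹⁰/16}`
  have hgrowth := Step8u016.growth_le hC0.le hℓ1 (by
    calc 8 * (14 + 57 * C) = Real.sqrt ((8 * (14 + 57 * C)) ^ 2) := by
          rw [Real.sqrt_sq (by positivity)]
      _ ≤ Real.sqrt (ell D) := Real.sqrt_le_sqrt hℓA)
  have hconst : 4 * (K₁ + K₂) ≤ Real.exp (ell D ^ 10 / 16) := by
    have h2 : ell D ≤ ell D ^ 10 := le_self_pow₀ hℓ1 (by norm_num)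
    calc 4 * (K₁ + K₂) ≤ ell D ^ 10 / 16 := by linarith
      _ ≤ ell D ^ 10 / 16 + 1 := by linarith
      _ ≤ Real.exp (ell D ^ 10 / 16) := Real.add_one_le_exp _
  have hP14 : bigP D ^ 14 = Real.exp (14 * ell D ^ 9) := by
    rw [bigP, ← Real.exp_nat_mul]; norm_num
  have hmid : bigP D ^ 14 * E' ≤ Real.exp (ell D ^ 10 / 8) := by
    rw [hE', hP14, ← Real.exp_add, Real.exp_le_exp]
    have : 14 * ell D ^ 9 + 3 * C * ell D ^ 9 * (1 + 9 * Real.log (ell D)) =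
        (14 + 3 * C) * ell D ^ 9 + 27 * C * ell D ^ 9 * Real.log (ell D) := by ring
    rw [this]; exact hgrowth
  have hfinal : 4 * ((K₁ + K₂) * X) ≤ 1 * Real.exp (-(1 / 16) * ell D ^ 10) := by
    have e : 4 * ((K₁ + K₂) * X) = (4 * (K₁ + K₂)) * (bigP D ^ 14 * E') * Real.exp (-(ell D ^ 10) / 4) := by
      rw [hX]; ring
    rw [e]
    have h1 := mul_le_mul hconst hmid (by positivity) (Real.exp_pos _).le
    have h2 := mul_le_mul_of_nonneg_right h1 (Real.exp_pos (-(ell D ^ 10) / 4)).le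
    refine h2.trans (le_of_eq ?_)
    rw [← Real.exp_add, ← Real.exp_add, one_mul]
    congr 1; ring
  have hπ : 1 * Real.exp (-(1 / 16) * ell D ^ 10) ≤ 1 * Real.exp (-(1 / 16) * ell D ^ 10) * (2 * π) :=
    le_mul_of_one_le_right (by positivity) (by linarith [Real.pi_gt_three])
  have h1 := mul_nonneg hK₁ hX0
  have h2 := mul_nonneg hK₂ hX0
  calc (ell D ^ 9 - alpha D) * (2 * (K₁ * bigP D ^ 10 * E' * Real.exp (-(ell D ^ 10) / 4))) +
        2 * ell1 D * (K₂ * bigP D ^ 13 * Real.exp (-(ell D ^ 10)))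
      ≤ 2 * (K₁ * X) + 2 * (K₂ * X) := add_le_add hH hV
    _ ≤ 4 * ((K₁ + K₂) * X) := by nlinarith [h1, h2]
    _ ≤ 1 * Real.exp (-(1 / 16) * ell D ^ 10) := hfinal
    _ ≤ 1 * Real.exp (-(1 / 16) * ell D ^ 10) * (2 * π) := hπ

omit [NeZero D] x in
/-- **`Z22:§16.u004` as an edge from Proposition 2.2 (i)** ("For `ψ ∈ Ψ₁`, moving the segment `𝔍(−α)`
to `𝔍(−𝓛⁹)` we obtain, by simple estimation, `I₃⁻(ψ) ≪ ε`"): if for `ψ ∈ Ψ₁` the zeros of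
`L(s,ψ)L(s,ψχ)` in `Ω` lie on the critical line (`Skeleton.Prop22i`), then for every `c′`, for all large
`D`, every `ψ ∈ Ψ₁` has `‖I₃⁻(ψ)‖ ≤ 1·e^{−𝓛¹⁰/16}` (`I₃⁻(ψ) = Typed.Section16A.I3pm c′ χ ψ (−α)`).
[cite: Zhang2022LandauSiegel, §16 p.89 (u004)] -/
theorem step16_u004_of_prop22i (h22 : Prop22i) (c' : ℝ) : Step16_u004 c' := by
  classical
  obtain ⟨C, hC0, hC⟩ := DirichletDisc.exp_neg_le_norm_LFunction
  obtain ⟨D₁, h22'⟩ := h22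
  set KB : ℝ := (1 + ‖iota2‖) * (‖iota3‖ + ‖iota4‖) with hKB
  have hKB0 : 0 ≤ KB := by rw [hKB]; positivity
  set K₁ : ℝ := Real.exp 3 * 72576 * KB * DirichletDisc.Zc with hK₁
  set K₂ : ℝ := Real.exp 3 * 36288 * KB * DirichletDisc.Zc with hK₂
  have hZ := DirichletDisc.one_le_Zc
  have hK₁0 : 0 ≤ K₁ := by rw [hK₁]; positivity
  have hK₂0 : 0 ≤ K₂ := by rw [hK₂]; positivity
  obtain ⟨D₃, hD₃f⟩ := Skeleton.exists_forall_le_ell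
    (max 10 (max (π * |c'| + 1) (max (64 * (4 * (K₁ + K₂)) + 1) ((8 * (14 + 57 * C)) ^ 2))))
  refine ⟨1 / 16, by norm_num, 1, max D₁ (max D₃ 3), fun D _ χ hD hq hp _ x hx => ?_⟩
  have hD₁ : D₁ ≤ D := le_trans (le_max_left _ _) hD
  have hD₃ : D₃ ≤ D := le_trans (le_trans (le_max_left _ _) (le_max_right _ _)) hD
  have hD3 : 3 ≤ D := le_trans (le_trans (le_max_right _ _) (le_max_right _ _)) hD
  have hM := hD₃f D hD₃
  have hℓ10 : 10 ≤ ell D := le_trans (le_max_left _ _) hM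
  have hℓc : π * |c'| + 1 ≤ ell D := le_trans (le_trans (le_max_left _ _) (le_max_right _ _)) hM
  have hℓK : 64 * (4 * (K₁ + K₂)) + 1 ≤ ell D :=
    le_trans (le_trans (le_trans (le_max_left _ _) (le_max_right _ _)) (le_max_right _ _)) hM
  have hℓA : (8 * (14 + 57 * C)) ^ 2 ≤ ell D :=
    le_trans (le_trans (le_trans (le_max_right _ _) (le_max_right _ _)) (le_max_right _ _)) hM
  have hℓ1 : 1 ≤ ell D := by linarith
  have hc8 : π * |c'| ≤ ell D ^ 8 := by
    have : ell D ≤ ell D ^ 8 := le_self_pow₀ hℓ1 (by norm_num)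
    linarith
  have h22x : ∀ s ∈ prodZeroSetOmega χ x, s.re = 1 / 2 := h22' D χ hD₁ hq hp x hx
  have hcore := norm_I3pm_neg_mul_le c' x hC0 hC h22x hD3 hp hℓ10 hc8
  have htail := tail_u004_le (K₁ := K₁) (K₂ := K₂) hC0 hK₁0 hK₂0 hℓ10 hℓK hℓA
  rw [hK₁, hK₂, hKB] at htail
  have h2π : (0 : ℝ) < 2 * π := by linarith [Real.pi_gt_three]
  exact le_of_mul_le_mul_right (hcore.trans htail) h2π

/-- **`Z22:§16.u004` HOLDS** ("`I₃⁻(ψ) ≪ ε`"): Proposition 2.2 (i) is the tree theorem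
`Skeleton.prop22i_holds`. [cite: Zhang2022LandauSiegel, §16 p.89 (u004)] -/
theorem step16_u004_holds (c' : ℝ) : Step16_u004 c' := step16_u004_of_prop22i prop22i_holds c'

end Assembly

end Literature.NumberTheory.LFunctions.Zhang2022.Step16u010

namespace Literature.NumberTheory.LFunctions.Zhang2022.Typed.Section16A

open Literature.NumberTheory.LFunctions.Zhang2022

/-- **The leaf `h16u010` of `Skeleton.theorem1_of_leaves_v19` CLOSED: `Z22:§16.u010` holds for every
sufficiently large `c′`** — "We can rewrite (16.1) as `Φ₂ = Θ₂(β₁,𝐤₂*,𝐚₂*) + o(𝔓)` with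
`κ₂* = κ₂ ∗ b₁` and `a₂* = g̃₂`" (`Typed.Section16A.Step16_u010 c′` BY NAME). Composition: u002 (the
residue step, `Step16u010.step16_u002_eventually`, zl-closer-1's engine over Prop. 2.2 at large `c′`) +
u004 (`Step16u010.step16_u004_holds`, this file) + u005/u010 bookkeeping with the move `𝔍(α) → 𝔍(1)`
and the Dirichlet-series identity on `𝔍(1)` (`Step16u010.step16_u010_of`, `Section16Step16u010`).
[cite: Zhang2022LandauSiegel, §16 p.89 (u010)] -/
theorem step16_u010_eventually : ∃ c₀ : ℝ, ∀ c' : ℝ, c₀ ≤ c' → Step16_u010 c' := by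
  obtain ⟨c₀, -, h⟩ := Step16u010.step16_u010_of_u004_eventually
  exact ⟨c₀, fun c' hc' => h c' hc' (Step16u010.step16_u004_holds c')⟩

variable (c' : ℝ) in
/-- `Step16_u004` — `_holds` alias of `Step16u010.step16_u004_holds` (this file) under the fact's exact name,
stated under the prover's own binders as section variables (appended 2026-08-28, D-0026 bookkeeping: the proof term is the
existing theorem of this file; no statement, definition or attribute is edited; no new named fact; the
ledger's debt table listed the fact unproved). [cite: Zhang2022LandauSiegel, §16 p.89 (u004)] -/
theorem Step16_u004_holds : Step16_u004 c' :=
  Step16u010.step16_u004_holds (c' := c')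

end Literature.NumberTheory.LFunctions.Zhang2022.Typed.Section16A
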